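import Mathlib
import HarnessLib
import Summits.Parity.GeneralizedHardyLittlewood.Theses.LiouvilleMAD
import Summits.Parity.GeneralizedHardyLittlewood.Theorems.DilatedChowla.Negative.DilatedChowlaMirrorDefs
import Summits.Parity.GeneralizedHardyLittlewood.Theorems.DilatedChowla.Negative.DilatedChowlaPretenderFalse
import Summits.Parity.GeneralizedHardyLittlewood.Theorems.LiouvilleMADEngineToGHL

/-!
# Crux `DilatedChowla` (stmt-Parity-13319) — ideator 5, round 2: checkable bookkeeping behind
`IDEATOR5-r2-report.md`

No idea card is filed in round 2 by this seat (see the report for the hunt and the verdict); this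
file records, kernel-checked, the two elementary identities the report leans on and the ONE
implication that classifies the crux inside the standard "two-point Möbius-randomness-in-progressions"
family (Polymath 8b §8 / the tree's `Literature.Barriers.Parity.Polymath2014_liouvillePairAP`):

* `S_cross_scale` — multiplying the two coordinates by the OTHER dilation,
  `λ(n')λ(n) · S c n n' M = Σ_{m∈(M,2M]} λ(nn'·m + n'c) · λ(nn'·m + nc)`:
  the equal-shift / distinct-dilation pencil of the crux IS an equal-dilation / distinct-shift
  two-point sum along ONE progression of modulus `q = nn' ≤ 4M²` (length `M`, height `≍ M·q`,
  i.e. level `2/3`), with shifts `a = n'c ≠ b = nc` of size `≤ 2|c|M`.  (The sibling crux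
  `LiouvilleShiftedTables.TableChowla` records the same move for its averaged family.)
* `S_slide` — moving the shift by a multiple of `nn'` slides the two columns against each other:
  `S (c + t·n·n') n n' M = Σ_m λ((m + t n')·n + c) · λ((m + t n)·n' + c)` (lag `t(n − n')`).
* `EqualDilationPairChowla` — power-saving two-point Chowla for EQUAL dilations `q ≤ 4M²` and
  distinct shifts `|a|,|b| ≤ 2|c|M` (a level-`2/3`, shift-uniform, power form of the Möbius
  randomness law for pairs in progressions), and the one-line classification
  `dilatedChowla_of_equalDilationPairChowla : EqualDilationPairChowla → DilatedChowla`.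
  This is a CLASSIFICATION, not a line: the hypothesis is a superset family of the crux with no
  why-easier (report §3), hence deliberately NOT filed as a transfer card.
* `pairsHL_of_dilatedChowla_of_elliottHalberstam` / `pairsHL_of_equalDilationPairChowla_of_elliottHalberstam`
  — since the route's three downstream reductions are PROVED tree theorems
  (`dilatedChowlaToTypeII_proof`, `TypeIIToLevel_proof`, `levelToPairs_proof`, composed in
  `Theorems/LiouvilleMADEngineToGHL`), the tree certifies TODAY: power-saving two-point Möbius
  randomness for pairs in progressions at level `2/3` (or just the crux) plus Elliott–Halberstam
  gives the Hardy–Littlewood pair asymptotic at every fixed shift (report §4(b)).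

Sorry-free.  Vocabulary (`S`, `L`, `L_natCast_mul_int`, `S_scale`) from the landed
`Theorems/DilatedChowla/Negative/*` and `Theorems/DilatedTableChowla/Negative/DilatedTableChowlaBlocks`.
-/

noncomputable section

namespace Summit.Parity.GeneralizedHardyLittlewood.Cruxes.DilatedChowla.Ideator5

open Summit.Parity.GeneralizedHardyLittlewood.Theses.LiouvilleMAD
open Summit.Parity.GeneralizedHardyLittlewood.Theorems.DilatedTableChowla.Negative
  (L L_of_pos L_mul_self_of_pos L_nonpos_arg abs_L_le_one L_natCast L_natCast_mul)
open Summit.Parity.GeneralizedHardyLittlewood.Theorems.DilatedChowla.Negative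
open Finset

/-! ## §1 Cross-scaling: the pencil as an equal-dilation two-point sum in one progression -/

/-- **Cross-scaling identity.**  For all `c, n, n', M`:
`Σ_{m∈(M,2M]} λ(m·(nn') + n'c) · λ(m·(nn') + nc) = λ(n') · λ(n) · S c n n' M`.
Proof: `n'(mn+c) = m(nn') + n'c`, `n(mn'+c) = m(nn') + nc`, and `λ(d·u) = λ(d)λ(u)` on all of `ℤ`
(`L_natCast_mul_int`, both sides `0` on nonpositive arguments). -/
theorem S_cross_scale (c : ℤ) (n n' M : ℕ) :
    ∑ m ∈ Ioc M (2 * M), L ((m : ℤ) * ((n * n' : ℕ) : ℤ) + (n' : ℤ) * c) *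
        L ((m : ℤ) * ((n * n' : ℕ) : ℤ) + (n : ℤ) * c) = L n' * L n * S c n n' M := by
  unfold S
  rw [mul_sum]
  refine sum_congr rfl fun m _ => ?_
  have h1 : (m : ℤ) * ((n * n' : ℕ) : ℤ) + (n' : ℤ) * c = (n' : ℤ) * ((m : ℤ) * n + c) := by
    push_cast; ring
  have h2 : (m : ℤ) * ((n * n' : ℕ) : ℤ) + (n : ℤ) * c = (n : ℤ) * ((m : ℤ) * n' + c) := by
    push_cast; ring
  rw [h1, h2, L_natCast_mul_int, L_natCast_mul_int]
  ring

/-- The signed form used below: `|Σ_m λ(m·nn' + n'c) λ(m·nn' + nc)| = |S c n n' M|` for `n, n' ≥ 1`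
(`λ(n)² = λ(n')² = 1`). -/
theorem abs_S_cross_scale (c : ℤ) {n n' : ℕ} (M : ℕ) (hn : 1 ≤ n) (hn' : 1 ≤ n') :
    |∑ m ∈ Ioc M (2 * M), L ((m : ℤ) * ((n * n' : ℕ) : ℤ) + (n' : ℤ) * c) *
        L ((m : ℤ) * ((n * n' : ℕ) : ℤ) + (n : ℤ) * c)| = |S c n n' M| := by
  rw [S_cross_scale, abs_mul, abs_mul]
  have h1 : |L (n' : ℤ)| = 1 := by
    have := L_mul_self_of_pos (n := (n' : ℤ)) (by exact_mod_cast hn')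
    have habs : |L (n' : ℤ)| * |L (n' : ℤ)| = 1 := by rw [← abs_mul, this, abs_one]
    nlinarith [abs_nonneg (L (n' : ℤ))]
  have h2 : |L (n : ℤ)| = 1 := by
    have := L_mul_self_of_pos (n := (n : ℤ)) (by exact_mod_cast hn)
    have habs : |L (n : ℤ)| * |L (n : ℤ)| = 1 := by rw [← abs_mul, this, abs_one]
    nlinarith [abs_nonneg (L (n : ℤ))]
  rw [h1, h2, one_mul, one_mul]

/-! ## §2 Sliding the shift by the modulus `nn'` = sliding the two columns against each other -/

/-- **Slide identity.**  `S (c + t·n·n') n n' M = Σ_{m∈(M,2M]} λ((m + t n')·n + c) · λ((m + t n)·n' + c)`: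
along the shift class `c mod nn'` the crux's family is the family of cross-correlations of the two
FIXED columns `m ↦ λ(mn+c)`, `m ↦ λ(mn'+c)` at lag `t·(n' − n)` over a window moved by `t n'`
(report §2 (F2): the only use is to explain why `c`-averaging inside one class is a lag average). -/
theorem S_slide (c t : ℤ) (n n' M : ℕ) :
    S (c + t * n * n') n n' M =
      ∑ m ∈ Ioc M (2 * M), L (((m : ℤ) + t * n') * n + c) * L (((m : ℤ) + t * n) * n' + c) := by
  unfold S
  refine sum_congr rfl fun m _ => ?_
  congr 1
  · congr 1; ring
  · congr 1; ring

/-! ## §3 The classification: equal-dilation pair-Chowla at level 2/3 contains the crux -/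

/-- **Equal-dilation two-point Chowla with power saving, level `2/3`, shift-uniform** (the dual
family): for every `c ≠ 0` there are `κ > 0`, `C` such that for all `M`, all moduli `1 ≤ q ≤ 4M²`
and all DISTINCT shifts `a ≠ b` with `|a|, |b| ≤ 2|c|M`:
`|Σ_{m∈(M,2M]} λ(mq + a) λ(mq + b)| ≤ C · M^{1−κ}`.
Each sum is `λ(U)λ(U + (b−a))` over the `M` terms `U ≡ a (mod q)` of a window at height `≍ qM ≤ 8M³`,
so `q ≤ 4M²` is level `θ = 2/3` in the progression variable; the random model gives `√(M log M)`.
A power/level-`2/3`/all-shifts form of the Möbius randomness law for PAIRS in progressions whose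
log-saving, level-`1−ε`, three-shift cousin is the tree's registered open conjecture
`Literature.Barriers.Parity.Polymath2014_liouvillePairAP` (Polymath 8b §8).  OPEN (its `q = 1`
slice is power-saving binary Chowla).  Recorded to classify the crux, not as a hypothesis anybody
should staff. -/
def EqualDilationPairChowla : Prop :=
  ∀ c : ℤ, c ≠ 0 → ∃ κ : ℝ, 0 < κ ∧ ∃ C : ℝ, ∀ M q : ℕ, ∀ a b : ℤ, 1 ≤ q → q ≤ 4 * M ^ 2 →
    a ≠ b → |a| ≤ 2 * |c| * M → |b| ≤ 2 * |c| * M →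
      |∑ m ∈ Ioc M (2 * M), L ((m : ℤ) * q + a) * L ((m : ℤ) * q + b)| ≤ C * (M : ℝ) ^ (1 - κ)

/-- **Classification.**  `EqualDilationPairChowla → DilatedChowla`: take `q = nn'`, `a = n'c`,
`b = nc` in the dual family and use `abs_S_cross_scale`.  (One line of bookkeeping; the converse
direction only recovers the sub-family `(q,a,b) = (nn', n'c, nc)`.) -/
theorem dilatedChowla_of_equalDilationPairChowla (h : EqualDilationPairChowla) : DilatedChowla := by
  rw [dilatedChowla_iff]
  intro c hc
  obtain ⟨κ, hκ, C, hC⟩ := h c hc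
  refine ⟨κ, hκ, C, fun M n n' hn hn' hne hnM hn'M => ?_⟩
  have hq1 : 1 ≤ n * n' := Nat.one_le_iff_ne_zero.mpr (Nat.mul_ne_zero (by omega) (by omega))
  have hq2 : n * n' ≤ 4 * M ^ 2 := by nlinarith
  have hab : (n' : ℤ) * c ≠ (n : ℤ) * c := by
    intro h'
    have : (n' : ℤ) = n := mul_right_cancel₀ hc h'
    exact hne (by exact_mod_cast this.symm)
  have ha : |(n' : ℤ) * c| ≤ 2 * |c| * M := by
    rw [abs_mul, Nat.abs_cast]
    have : (n' : ℤ) ≤ 2 * M := by exact_mod_cast hn'M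
    nlinarith [abs_nonneg c]
  have hb : |(n : ℤ) * c| ≤ 2 * |c| * M := by
    rw [abs_mul, Nat.abs_cast]
    have : (n : ℤ) ≤ 2 * M := by exact_mod_cast hnM
    nlinarith [abs_nonneg c]
  have key := hC M (n * n') ((n' : ℤ) * c) ((n : ℤ) * c) hq1 hq2 hab ha hb
  rwa [abs_S_cross_scale c M hn hn'] at key

/-! ## §4 The quotable corollary (all glue below the node is proved in tree) -/

/-- `DilatedChowla ∧ ElliottHalberstam ⇒ PairsHL` — the node plus the bridge premise already give
binary Hardy–Littlewood at every fixed shift, by the three PROVED reductions of route LiouvilleMAD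
(Cauchy–Schwarz, Vaughan/Heath-Brown + BV for `λ`, Murty–Vatwani in `λ`-form). -/
theorem pairsHL_of_dilatedChowla_of_elliottHalberstam (h : DilatedChowla) (hEH : ElliottHalberstam) :
    Summit.Parity.GeneralizedHardyLittlewood.Theses.LiouvilleShiftedTables.PairsHL :=
  Theorems.levelToPairs_proof
    (Theorems.TypeIIToLevel.TypeIIToLevel_proof (Theorems.dilatedChowlaToTypeII_proof h)) hEH

/-- **Corollary (classification form).**  Power-saving Möbius randomness for PAIRS in progressions
at level `2/3` (`EqualDilationPairChowla`) together with the Elliott–Halberstam conjecture implies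
`Σ_{n≤N} Λ(n)Λ(n+h) = 𝔖({0,h})·N + o(N)` for every `h ≥ 1`.  Contrast Polymath 8b §8: the
LOG-saving one- and two-point Möbius-randomness inputs at level `1−ε` (the tree's registered
`Polymath2014_liouvilleShiftAPConjecture`, `Polymath2014_liouvillePairAP`) cannot give pairs through
any weight-insertion-invariant argument (tree barrier `Literature.Barriers.Parity.PrimePairParity`);
the POWER-saving, dilation-uniform two-point law feeds a bilinear Type-II bound for `λ(mn+c)`
(`DilatedChowlaToTypeII`), which is outside that class. -/
theorem pairsHL_of_equalDilationPairChowla_of_elliottHalberstam (h : EqualDilationPairChowla)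
    (hEH : ElliottHalberstam) : Summit.Parity.GeneralizedHardyLittlewood.Theses.LiouvilleShiftedTables.PairsHL :=
  pairsHL_of_dilatedChowla_of_elliottHalberstam (dilatedChowla_of_equalDilationPairChowla h) hEH

end Summit.Parity.GeneralizedHardyLittlewood.Cruxes.DilatedChowla.Ideator5

end
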